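import Literature.NumberTheory.Sieve.HeathBrownCubicLemma95
import Literature.NumberTheory.Sieve.HeathBrownCubicGrossenTrivial
import HarnessLib

/-!
# Heath-Brown's `E(𝐱)` and its Fourier decomposition (9.4): the core of Lemma 9.3

Part of the reduction *Lemma 9.2 ⇐ Lemma 9.4* in §9 of D. R. Heath-Brown, *Primes represented by
`x³ + 2y³`*, Acta Math. 186 (2001) (this seat's route to the named fact `HeathBrown2001_lemma_3_8`).
Page 54: "We proceed to study `E(𝐱) = ∑_{N(𝐱) < N(S) ≤ N(𝐱)+ΔV} d_S ν₀(S) W(S; Δ, 𝐱)` … LEMMA 9.3. Let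
`𝐱 ∈ 𝒞` and suppose that `q ≤ (log L)^A`. Then
`E(𝐱) = ε(χ) m(𝐱) (Δ²/M)(ξ log X)^{−n−1} + O_A(Δ^{−2}M^{−1}V exp{−c√(log L)})` (9.3), where
`m(𝐱) = w(N(𝐱)+ΔV) − w(N(𝐱))` and `ε(χ) = 1` or `0` depending on whether `χ` is trivial or not. We begin by
observing that `E(𝐱) = Δ² ∑_{j,k} (sin πjΔ/πjΔ)² (sin πkΔ/πkΔ)² ν₁(𝐱)^{−j} ν₂(𝐱)^{−k} E_{j,k}` (9.4), where
`E_{j,k} = ∑ d_S ν^{(j,k)}(S)`." This file sets up `E`, `E_{j,k}` over the TUPLES of first-degree primes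
(`d_S` is by definition the sum over the tuples with product `S`, `HeathBrownCubicTypeII.dWeight`) and
proves the decomposition and the abstract form of Lemma 9.3:

* `primeTuples`, `tupleIdeal`, `tupleCoeff`, `tupleNorm`, the window `InNormWindow Δ V 𝐱`,
  `idealWeight Δ S 𝐱 = W(S; Δ, 𝐱)` (through a generator, `HeathBrownCubicLemma95.pairWeight`), and
  **`Esum` (`E(𝐱)`), `Ejk` (`E_{j,k}(𝐱)`), `Eabs`** (the absolute mass of the window);
* `norm_Esum_sub_doubleSum_le` — **(9.4), truncated**: with `ĉ = tentCoeff Δ` and `ε = Δ⁻¹/√K₀`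
  (Bernstein, `Literature.Analysis.Fourier.norm_angTent_sub_sum_le`),
  `|E(𝐱) − ∑_{|j|,|k|<K₀} ĉ(j)ĉ(k)ν₁(𝐱)^{−j}ν₂(𝐱)^{−k}E_{j,k}(𝐱)| ≤ 3ε Eabs(𝐱)` (the characters enter through
  `grossenChar_eq_nu0O_mul`: `ν^{(j,k)}(S) = ν₀(g)ν₁(ĝ)^jν₂(ĝ)^k`);
* `norm_Esum_sub_main_le` — **Lemma 9.3, abstract form**: if the non-trivial `E_{j,k}` (`|j|,|k| < K₀`) are
  `≤ B₁` and, for `χ = χ₀`, `E_{0,0} = main + O(B₂)`, then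
  `|E(𝐱) − ε(χ)Δ²main| ≤ 3εEabs + ((∑|ĉ|)² + 1)B₁ + Δ²B₂` (`ĉ(0) = Δ`; the trivial characters are exactly
  `χ = χ₀, j = k = 0`, `isTrivialMod_iff`). The inputs `B₁` (from Lemma 9.4, (9.7)–(9.9)), `B₂` (from Lemma 4.10,
  (9.5)–(9.6)) and the trivial bound for `Eabs` ((9.10)) are supplied by the sequel files.

## References

* D. R. Heath-Brown, *Primes represented by `x³ + 2y³`*, Acta Math. 186 (2001), §9 pp. 54–56, Lemma 9.3,
  (9.4)–(9.10). [cite: HeathBrownActa2001, Lemma 9.3]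
* G. Harman, *Prime-Detecting Sieves* (2007), Lemma 13.20, (13.6.12)–(13.6.15). [cite: Harman2007, Lemma 13.20]

## Mathlib / tree search

Tree: `HeathBrownCubicLemma95` (`pairWeight`, `idealGen`-based weights), `HeathBrownCubicGrossen` (`grossenChar_of_ne_bot`,
`nuO`, `norm_nu1`, `norm_nu2`, `norm_grossenChar_le`), `HeathBrownCubicGrossenTrivial` (`isTrivialMod_iff`), `TentFunction`
(`tentCoeff`, `tentCoeff_zero`, `norm_angTent_sub_sum_le`), `HeathBrownCubicTypeII` (`Jprimes`, `hbXi`). Mathlib: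
`Fintype.piFinset`, `Finset.sum_comm`, `Finset.sum_mul_sum`, `Finset.sum_ite_eq'`, `norm_add₃_le`.
-/

noncomputable section

open Polynomial NumberField Finset Complex

namespace Literature.NumberTheory.Sieve.CubicSieve

open LFunctions.CubeRootTwoField CubicPrimes Literature.Analysis.Fourier

/-! ### Tuples of first-degree primes and the sums `E(𝐱)`, `E_{j,k}(𝐱)` -/

section Defs

variable (X τ : ℝ) {n : ℕ} (m : Fin (n + 1) → ℕ)

/-- The tuples `(P_1, …, P_{n+1})` of first-degree primes with `N(P_i) ∈ J(m_i)` — the support of `d_S`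
("`d_S` will be supported on ideals `S = ∏ P_i`, where `P_i` are first degree prime ideals with
`N(P_i) ∈ J(m_i)`", p. 14). [cite: HeathBrownActa2001, §3 p. 14] -/
abbrev primeTuples : Finset (Fin (n + 1) → Ideal (𝓞 K)) := Fintype.piFinset fun i => Jprimes X τ (m i)

/-- The ideal `S = ∏ P_i` of a tuple. [cite: HeathBrownActa2001, §3 p. 14] -/
def tupleIdeal (P : Fin (n + 1) → Ideal (𝓞 K)) : Ideal (𝓞 K) := ∏ i, P i

/-- The coefficient `∏ log N(P_i)/(m_i ξ log X)` of a tuple (the summand of `d_S`, p. 15).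
[cite: HeathBrownActa2001, §3 p. 15] -/
def tupleCoeff (P : Fin (n + 1) → Ideal (𝓞 K)) : ℝ :=
  ∏ i, Real.log (Ideal.absNorm (P i)) / ((m i : ℝ) * hbXi τ * Real.log X)

/-- The norm `∏ N(P_i) = N(S)` of a tuple, as a real number. [folklore] -/
def tupleNorm (P : Fin (n + 1) → Ideal (𝓞 K)) : ℝ := ∏ i, (Ideal.absNorm (P i) : ℝ)

/-- The norm window `N(𝐱) < N(S) ≤ N(𝐱) + ΔV` of `E(𝐱)` (p. 54). [cite: HeathBrownActa2001, §9 p. 54] -/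
def InNormWindow (Δ V : ℝ) (x : ℝ × ℝ × ℝ) (P : Fin (n + 1) → Ideal (𝓞 K)) : Prop :=
  normForm x < tupleNorm P ∧ tupleNorm P ≤ normForm x + Δ * V

/-- The window condition is decidable (two real inequalities). [folklore] -/
instance instDecidableInNormWindow (Δ V : ℝ) (x : ℝ × ℝ × ℝ) (P : Fin (n + 1) → Ideal (𝓞 K)) :
    Decidable (InNormWindow Δ V x P) := by
  unfold InNormWindow; infer_instance

/-- **`W(S; Δ, 𝐱)`** for an ideal `S` (through a generator; independent of the choice). [cite: HeathBrownActa2001, §9 p. 53] -/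
def idealWeight (Δ : ℝ) (S : Ideal (𝓞 K)) (x : ℝ × ℝ × ℝ) : ℝ := pairWeight Δ (realVec (idealGen S)) x

variable {q : ℕ} (hq : 1 ≤ q) (χ : MulChar (QuotMod q) ℂ)

/-- **`E_{j,k}(𝐱) = ∑_{N(𝐱) < N(S) ≤ N(𝐱)+ΔV} d_S ν^{(j,k)}(S)`** (p. 54), written over the tuples (`d_S` is
the sum over the tuples with product `S`). [cite: HeathBrownActa2001, §9 p. 54] -/
def Ejk (j k : ℤ) (Δ V : ℝ) (x : ℝ × ℝ × ℝ) : ℂ :=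
  ∑ P ∈ primeTuples X τ m, if InNormWindow Δ V x P then (tupleCoeff X τ m P : ℂ) * grossenChar hq χ j k (tupleIdeal P) else 0

/-- **`E(𝐱) = ∑_{N(𝐱) < N(S) ≤ N(𝐱)+ΔV} d_S ν₀(S) W(S; Δ, 𝐱)`** (p. 54), over the tuples.
[cite: HeathBrownActa2001, §9 p. 54] -/
def Esum (Δ V : ℝ) (x : ℝ × ℝ × ℝ) : ℂ :=
  ∑ P ∈ primeTuples X τ m, if InNormWindow Δ V x P then
    (tupleCoeff X τ m P : ℂ) * grossenChar hq χ 0 0 (tupleIdeal P) * (idealWeight Δ (tupleIdeal P) x : ℂ) else 0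

/-- The absolute mass `∑_{window} |∏ log N(P_i)/(m_iξ log X)|` of the window (for the trivial bound (9.10)).
[cite: HeathBrownActa2001, §9 (9.10)] -/
def Eabs (Δ V : ℝ) (x : ℝ × ℝ × ℝ) : ℝ :=
  ∑ P ∈ primeTuples X τ m, if InNormWindow Δ V x P then |tupleCoeff X τ m P| else 0

end Defs

/-! ### Basic facts on tuples -/

section Basic

variable {X τ : ℝ} {n : ℕ} {m : Fin (n + 1) → ℕ}

/-- The product ideal of a tuple of primes in the support is non-zero. [folklore] -/
theorem tupleIdeal_ne_bot {P : Fin (n + 1) → Ideal (𝓞 K)} (hP : P ∈ primeTuples X τ m) : tupleIdeal P ≠ ⊥ := by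
  rw [tupleIdeal, Ne, ← Ideal.zero_eq_bot, Finset.prod_eq_zero_iff]
  rintro ⟨i, -, hi⟩
  rw [Ideal.zero_eq_bot] at hi
  have h := Fintype.mem_piFinset.mp hP i
  rw [mem_Jprimes_iff] at h
  exact h.2.1 hi

/-- `N(S) = ∏ N(P_i)`. [folklore] -/
theorem absNorm_tupleIdeal (P : Fin (n + 1) → Ideal (𝓞 K)) : (Ideal.absNorm (tupleIdeal P) : ℝ) = tupleNorm P := by
  rw [tupleIdeal, tupleNorm, map_prod, Nat.cast_prod]

/-- `Eabs ≥ 0`. [folklore] -/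
theorem Eabs_nonneg (Δ V : ℝ) (x : ℝ × ℝ × ℝ) : 0 ≤ Eabs X τ m Δ V x :=
  Finset.sum_nonneg fun P _ => by split_ifs <;> simp [abs_nonneg]

end Basic

/-! ### The Fourier decomposition (9.4) of `E(𝐱)`, truncated -/

section Decomposition

variable {X τ : ℝ} {n : ℕ} {m : Fin (n + 1) → ℕ} {q : ℕ} (hq : 1 ≤ q) (χ : MulChar (QuotMod q) ℂ)

/-- **`ν^{(j,k)}(S)` through the generator vector**: for `S ≠ 0` with generator `g` and `b = ĝ`,
`ν^{(j,k)}(S) = ν₀(g) ν₁(b)^j ν₂(b)^k`. [cite: HeathBrownActa2001, §9 p. 54] -/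
theorem grossenChar_eq_nu0O_mul {S : Ideal (𝓞 K)} (hS : S ≠ ⊥) (j k : ℤ) :
    grossenChar hq χ j k S = nu0O χ (idealGen S) * nu1 (realVec (idealGen S)) ^ j * nu2 (realVec (idealGen S)) ^ k := by
  rw [grossenChar_of_ne_bot hq χ j k hS, nuO]; rfl

/-- Powers of a quotient: `(a/u)^j = a^j (u^j)⁻¹`. [folklore] -/
theorem div_zpow_eq_mul_inv (a u : ℂ) (j : ℤ) : (a / u) ^ j = a ^ j * (u ^ j)⁻¹ := by
  rw [div_zpow, div_eq_mul_inv]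

/-- The product of two truncation errors: if `‖h_i − T_i‖ ≤ ε ≤ 1` and `‖h_i‖ ≤ 1` then
`‖h₁h₂ − T₁T₂‖ ≤ 3ε`. [folklore] -/
theorem norm_mul_sub_mul_le_three {h₁ h₂ T₁ T₂ : ℂ} {ε : ℝ} (hε : 0 ≤ ε) (hε1 : ε ≤ 1) (h1 : ‖h₁‖ ≤ 1) (h2 : ‖h₂‖ ≤ 1)
    (hT₁ : ‖h₁ - T₁‖ ≤ ε) (hT₂ : ‖h₂ - T₂‖ ≤ ε) : ‖h₁ * h₂ - T₁ * T₂‖ ≤ 3 * ε := by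
  have hT₁n : ‖T₁‖ ≤ 1 + ε := by
    calc ‖T₁‖ = ‖h₁ - (h₁ - T₁)‖ := by ring_nf
      _ ≤ ‖h₁‖ + ‖h₁ - T₁‖ := norm_sub_le _ _
      _ ≤ 1 + ε := add_le_add h1 hT₁
  calc ‖h₁ * h₂ - T₁ * T₂‖ = ‖(h₁ - T₁) * h₂ + T₁ * (h₂ - T₂)‖ := by ring_nf
    _ ≤ ‖h₁ - T₁‖ * ‖h₂‖ + ‖T₁‖ * ‖h₂ - T₂‖ := by
        refine (norm_add_le _ _).trans ?_; rw [norm_mul, norm_mul]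
    _ ≤ ε * 1 + (1 + ε) * ε := by gcongr
    _ ≤ 3 * ε := by nlinarith

/-- **The truncated Fourier decomposition of `E(𝐱)`** ((9.4) with Bernstein's truncation in place of the
absolutely convergent expansion): for `N(𝐱) ≠ 0`, `0 < Δ`, `K₀ ≥ 1` and `ε = Δ⁻¹/√K₀ ≤ 1`,
`E(𝐱) = ∑_{|j|,|k|<K₀} ĉ(j)ĉ(k) ν₁(𝐱)^{−j} ν₂(𝐱)^{−k} E_{j,k}(𝐱) + O(3ε · Eabs(𝐱))`.
[cite: HeathBrownActa2001, §9 (9.4)] -/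
theorem norm_Esum_sub_doubleSum_le {Δ V : ℝ} (hΔ : 0 < Δ) {x : ℝ × ℝ × ℝ} (hx : normForm x ≠ 0)
    {K₀ : ℕ} (hK : 1 ≤ K₀) (hε : 1 / Δ / Real.sqrt K₀ ≤ 1) :
    ‖Esum X τ m hq χ Δ V x -
        ∑ j ∈ Finset.Ioo (-(K₀ : ℤ)) K₀, ∑ k ∈ Finset.Ioo (-(K₀ : ℤ)) K₀,
          tentCoeff Δ j * tentCoeff Δ k * ((nu1 x ^ j)⁻¹ * (nu2 x ^ k)⁻¹) * Ejk X τ m hq χ j k Δ V x‖ ≤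
      3 * (1 / Δ / Real.sqrt K₀) * Eabs X τ m Δ V x := by
  classical
  set ε : ℝ := 1 / Δ / Real.sqrt K₀ with hεdef
  have hε0 : 0 ≤ ε := by positivity
  set u : ℂ := nu1 x with hu
  set v : ℂ := nu2 x with hv
  have hu0 : u ≠ 0 := by rw [hu, ← norm_ne_zero_iff, norm_nu1 hx]; exact one_ne_zero
  have hv0 : v ≠ 0 := by rw [hv, ← norm_ne_zero_iff, norm_nu2]; exact one_ne_zero
  set IK := Finset.Ioo (-(K₀ : ℤ)) K₀ with hIK
  -- truncated expansions attached to a tuple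
  let T₁ : (Fin (n + 1) → Ideal (𝓞 K)) → ℂ := fun P =>
    ∑ j ∈ IK, tentCoeff Δ j * (nu1 (realVec (idealGen (tupleIdeal P))) / u) ^ j
  let T₂ : (Fin (n + 1) → Ideal (𝓞 K)) → ℂ := fun P =>
    ∑ k ∈ IK, tentCoeff Δ k * (nu2 (realVec (idealGen (tupleIdeal P))) / v) ^ k
  -- the double sum, rewritten over the tuples
  have hswap : ∑ j ∈ IK, ∑ k ∈ IK, tentCoeff Δ j * tentCoeff Δ k * ((u ^ j)⁻¹ * (v ^ k)⁻¹) * Ejk X τ m hq χ j k Δ V x =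
      ∑ P ∈ primeTuples X τ m, if InNormWindow Δ V x P then
        (tupleCoeff X τ m P : ℂ) * grossenChar hq χ 0 0 (tupleIdeal P) * (T₁ P * T₂ P) else 0 := by
    have h1 : ∀ j ∈ IK, ∀ k ∈ IK, tentCoeff Δ j * tentCoeff Δ k * ((u ^ j)⁻¹ * (v ^ k)⁻¹) * Ejk X τ m hq χ j k Δ V x =
        ∑ P ∈ primeTuples X τ m, if InNormWindow Δ V x P then
          tentCoeff Δ j * tentCoeff Δ k * ((u ^ j)⁻¹ * (v ^ k)⁻¹) * ((tupleCoeff X τ m P : ℂ) * grossenChar hq χ j k (tupleIdeal P)) else 0 := by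
      intro j _ k _
      rw [Ejk, Finset.mul_sum]
      refine Finset.sum_congr rfl fun P _ => ?_
      split_ifs <;> simp
    rw [Finset.sum_congr rfl fun j hj => Finset.sum_congr rfl fun k hk => h1 j hj k hk]
    rw [Finset.sum_comm]
    simp_rw [Finset.sum_comm (s := IK) (t := primeTuples X τ m)]
    refine Finset.sum_congr rfl fun P hP => ?_
    by_cases hw : InNormWindow Δ V x P
    · simp only [if_pos hw]
      have hS := tupleIdeal_ne_bot hP
      simp only [T₁, T₂]
      rw [Finset.sum_mul_sum, Finset.sum_comm, Finset.mul_sum]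
      refine Finset.sum_congr rfl fun k _ => ?_
      rw [Finset.mul_sum]
      refine Finset.sum_congr rfl fun j _ => ?_
      rw [grossenChar_eq_nu0O_mul hq χ hS k j, grossenChar_eq_nu0O_mul hq χ hS 0 0, zpow_zero, zpow_zero, mul_one, mul_one,
        div_zpow_eq_mul_inv, div_zpow_eq_mul_inv]
      ring
    · simp only [if_neg hw, Finset.sum_const_zero]
  rw [hswap, Esum, ← Finset.sum_sub_distrib]
  -- termwise bound
  have hterm : ∀ P ∈ primeTuples X τ m,
      ‖(if InNormWindow Δ V x P then (tupleCoeff X τ m P : ℂ) * grossenChar hq χ 0 0 (tupleIdeal P) *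
            (idealWeight Δ (tupleIdeal P) x : ℂ) else 0) -
        (if InNormWindow Δ V x P then (tupleCoeff X τ m P : ℂ) * grossenChar hq χ 0 0 (tupleIdeal P) * (T₁ P * T₂ P) else 0)‖ ≤
      3 * ε * (if InNormWindow Δ V x P then |tupleCoeff X τ m P| else 0) := by
    intro P hP
    by_cases hw : InNormWindow Δ V x P
    · simp only [if_pos hw]
      have hS := tupleIdeal_ne_bot hP
      set b := realVec (idealGen (tupleIdeal P)) with hb
      have hNb : normForm b ≠ 0 := normForm_realVec_ne_zero (idealGen_ne_zero hS)
      have hw1 : ‖nu1 b / u‖ = 1 := by rw [norm_div, norm_nu1 hNb, hu, norm_nu1 hx, div_one]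
      have hw2 : ‖nu2 b / v‖ = 1 := by rw [norm_div, norm_nu2, hv, norm_nu2, div_one]
      have hT₁ := norm_angTent_sub_sum_le hΔ hK hw1
      have hT₂ := norm_angTent_sub_sum_le hΔ hK hw2
      have hW : (idealWeight Δ (tupleIdeal P) x : ℂ) = (angTent Δ (nu1 b / u) : ℂ) * (angTent Δ (nu2 b / v) : ℂ) := by
        rw [idealWeight, pairWeight]; push_cast; rfl
      have h3 : ‖(angTent Δ (nu1 b / u) : ℂ) * (angTent Δ (nu2 b / v) : ℂ) - T₁ P * T₂ P‖ ≤ 3 * ε :=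
        norm_mul_sub_mul_le_three hε0 hε (by rw [Complex.norm_real, Real.norm_eq_abs, abs_of_nonneg (angTent_nonneg _ _)]; exact angTent_le_one hΔ _)
          (by rw [Complex.norm_real, Real.norm_eq_abs, abs_of_nonneg (angTent_nonneg _ _)]; exact angTent_le_one hΔ _) hT₁ hT₂
      rw [← mul_sub, hW, norm_mul, norm_mul, Complex.norm_real, Real.norm_eq_abs]
      have hν : ‖grossenChar hq χ 0 0 (tupleIdeal P)‖ ≤ 1 := norm_grossenChar_le hq χ 0 0 _
      calc |tupleCoeff X τ m P| * ‖grossenChar hq χ 0 0 (tupleIdeal P)‖ * ‖(angTent Δ (nu1 b / u) : ℂ) * (angTent Δ (nu2 b / v) : ℂ) - T₁ P * T₂ P‖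
          ≤ |tupleCoeff X τ m P| * 1 * (3 * ε) := by gcongr
        _ = 3 * ε * |tupleCoeff X τ m P| := by ring
    · simp only [if_neg hw, sub_zero, norm_zero, mul_zero]; exact le_rfl
  calc ‖∑ P ∈ primeTuples X τ m, ((if InNormWindow Δ V x P then (tupleCoeff X τ m P : ℂ) * grossenChar hq χ 0 0 (tupleIdeal P) *
            (idealWeight Δ (tupleIdeal P) x : ℂ) else 0) -
          (if InNormWindow Δ V x P then (tupleCoeff X τ m P : ℂ) * grossenChar hq χ 0 0 (tupleIdeal P) * (T₁ P * T₂ P) else 0))‖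
      ≤ ∑ P ∈ primeTuples X τ m, 3 * ε * (if InNormWindow Δ V x P then |tupleCoeff X τ m P| else 0) :=
        (norm_sum_le _ _).trans (Finset.sum_le_sum hterm)
    _ = 3 * ε * Eabs X τ m Δ V x := by rw [Eabs, Finset.mul_sum]

/-- **Lemma 9.3, abstract form** — the assembly of (9.4), (9.6), (9.9), (9.10): if every NON-TRIVIAL
`E_{j,k}(𝐱)` with `|j|, |k| < K₀` is bounded by `B₁ ≥ 0`, and for `χ = χ₀` the trivial one `E_{0,0}(𝐱)` is
`main + O(B₂)`, then
`|E(𝐱) − ε(χ)Δ²·main| ≤ 3εEabs(𝐱) + ((∑_{|j|<K₀}|ĉ(j)|)² + 1)B₁ + Δ²B₂`, `ε = Δ⁻¹/√K₀`, `ε(χ) = [χ = χ₀]`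
(the trivial characters are exactly `χ = χ₀, j = k = 0`, `isTrivialMod_iff`; `ĉ(0) = Δ`).
[cite: HeathBrownActa2001, Lemma 9.3] -/
theorem norm_Esum_sub_main_le [Decidable (χ = 1)] {Δ V : ℝ} (hΔ : 0 < Δ) (hΔ2 : Δ ≤ 1 / 2) {x : ℝ × ℝ × ℝ}
    (hx : normForm x ≠ 0) {K₀ : ℕ} (hK : 1 ≤ K₀) (hε : 1 / Δ / Real.sqrt K₀ ≤ 1) {B₁ B₂ main : ℝ} (hB₁0 : 0 ≤ B₁)
    (hB₂0 : 0 ≤ B₂)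
    (hB₁ : ∀ j k : ℤ, j ∈ Finset.Ioo (-(K₀ : ℤ)) K₀ → k ∈ Finset.Ioo (-(K₀ : ℤ)) K₀ →
      ¬ IsTrivialMod q (grossenChar hq χ j k) → ‖Ejk X τ m hq χ j k Δ V x‖ ≤ B₁)
    (hB₂ : χ = 1 → ‖Ejk X τ m hq χ 0 0 Δ V x - main‖ ≤ B₂) :
    ‖Esum X τ m hq χ Δ V x - (if χ = 1 then ((Δ ^ 2 * main : ℝ) : ℂ) else 0)‖ ≤
      3 * (1 / Δ / Real.sqrt K₀) * Eabs X τ m Δ V x +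
        ((∑ j ∈ Finset.Ioo (-(K₀ : ℤ)) K₀, ‖tentCoeff Δ j‖) ^ 2 + 1) * B₁ + Δ ^ 2 * B₂ := by
  classical
  set IK := Finset.Ioo (-(K₀ : ℤ)) K₀ with hIK
  have h0mem : (0 : ℤ) ∈ IK := by rw [hIK, Finset.mem_Ioo]; omega
  set u : ℂ := nu1 x with hu
  set v : ℂ := nu2 x with hv
  have hun : ‖u‖ = 1 := by rw [hu, norm_nu1 hx]
  have hvn : ‖v‖ = 1 := by rw [hv, norm_nu2]
  let t : ℤ → ℤ → ℂ := fun j k => tentCoeff Δ j * tentCoeff Δ k * ((u ^ j)⁻¹ * (v ^ k)⁻¹) * Ejk X τ m hq χ j k Δ V x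
  set D : ℂ := ∑ j ∈ IK, ∑ k ∈ IK, t j k with hD
  have hdec := norm_Esum_sub_doubleSum_le (X := X) (τ := τ) (m := m) hq χ (V := V) hΔ hx hK hε
  rw [← hIK] at hdec
  change ‖Esum X τ m hq χ Δ V x - D‖ ≤ 3 * (1 / Δ / Real.sqrt K₀) * Eabs X τ m Δ V x at hdec
  -- `D - t 0 0` is small
  have ht00 : t 0 0 = (Δ : ℂ) ^ 2 * Ejk X τ m hq χ 0 0 Δ V x := by
    simp only [t, zpow_zero, inv_one, mul_one, tentCoeff_zero hΔ hΔ2]; ring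
  have hsum00 : ∑ j ∈ IK, ∑ k ∈ IK, (if j = 0 ∧ k = 0 then t j k else 0) = t 0 0 := by
    have : ∀ j ∈ IK, ∑ k ∈ IK, (if j = 0 ∧ k = 0 then t j k else 0) = if j = 0 then t j 0 else 0 := by
      intro j _
      by_cases hj : j = 0
      · simp only [hj, true_and, if_true]
        rw [Finset.sum_ite_eq' IK (0 : ℤ) (fun k => t 0 k), if_pos h0mem]
      · simp [hj]
    rw [Finset.sum_congr rfl this, Finset.sum_ite_eq' IK (0 : ℤ) (fun j => t j 0), if_pos h0mem]
  have hDt : ‖D - t 0 0‖ ≤ (∑ j ∈ IK, ‖tentCoeff Δ j‖) ^ 2 * B₁ := by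
    rw [← hsum00, hD, ← Finset.sum_sub_distrib]
    simp_rw [← Finset.sum_sub_distrib]
    have hterm : ∀ j ∈ IK, ∀ k ∈ IK, ‖t j k - (if j = 0 ∧ k = 0 then t j k else 0)‖ ≤ ‖tentCoeff Δ j‖ * ‖tentCoeff Δ k‖ * B₁ := by
      intro j hj k hk
      by_cases hjk : j = 0 ∧ k = 0
      · rw [if_pos hjk, sub_self, norm_zero]; positivity
      · rw [if_neg hjk, sub_zero]
        have hnt : ¬ IsTrivialMod q (grossenChar hq χ j k) := fun h => hjk ((isTrivialMod_iff hq).mp h).2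
        simp only [t, norm_mul, norm_inv, norm_zpow, hun, hvn, one_zpow, inv_one, mul_one]
        exact mul_le_mul_of_nonneg_left (hB₁ j k hj hk hnt) (by positivity)
    calc ‖∑ j ∈ IK, ∑ k ∈ IK, (t j k - if j = 0 ∧ k = 0 then t j k else 0)‖
        ≤ ∑ j ∈ IK, ‖∑ k ∈ IK, (t j k - if j = 0 ∧ k = 0 then t j k else 0)‖ := norm_sum_le _ _
      _ ≤ ∑ j ∈ IK, ∑ k ∈ IK, ‖tentCoeff Δ j‖ * ‖tentCoeff Δ k‖ * B₁ :=
          Finset.sum_le_sum fun j hj => (norm_sum_le _ _).trans (Finset.sum_le_sum fun k hk => hterm j hj k hk)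
      _ = (∑ j ∈ IK, ‖tentCoeff Δ j‖) ^ 2 * B₁ := by
          rw [sq, Finset.sum_mul_sum, Finset.sum_mul]
          refine Finset.sum_congr rfl fun j _ => ?_
          rw [Finset.sum_mul]
  -- the term `t 0 0 = Δ² E_{0,0}`
  have hmainterm : ‖t 0 0 - (if χ = 1 then ((Δ ^ 2 * main : ℝ) : ℂ) else 0)‖ ≤ B₁ + Δ ^ 2 * B₂ := by
    rw [ht00]
    by_cases hχ : χ = 1
    · rw [if_pos hχ]
      have h := hB₂ hχ
      have : (Δ : ℂ) ^ 2 * Ejk X τ m hq χ 0 0 Δ V x - ((Δ ^ 2 * main : ℝ) : ℂ) = (Δ : ℂ) ^ 2 * (Ejk X τ m hq χ 0 0 Δ V x - main) := by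
        push_cast; ring
      rw [this, norm_mul, norm_pow, Complex.norm_real, Real.norm_eq_abs, abs_of_pos hΔ]
      nlinarith [mul_le_mul_of_nonneg_left h (sq_nonneg Δ)]
    · rw [if_neg hχ, sub_zero, norm_mul, norm_pow, Complex.norm_real, Real.norm_eq_abs, abs_of_pos hΔ]
      have hnt : ¬ IsTrivialMod q (grossenChar hq χ 0 0) := fun h => hχ ((isTrivialMod_iff hq).mp h).1
      have h := hB₁ 0 0 h0mem h0mem hnt
      have hΔ1 : Δ ^ 2 ≤ 1 := by nlinarith
      have hB₂' : 0 ≤ Δ ^ 2 * B₂ := by positivity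
      calc Δ ^ 2 * ‖Ejk X τ m hq χ 0 0 Δ V x‖ ≤ 1 * B₁ := mul_le_mul hΔ1 h (norm_nonneg _) zero_le_one
        _ ≤ B₁ + Δ ^ 2 * B₂ := by linarith
  calc ‖Esum X τ m hq χ Δ V x - (if χ = 1 then ((Δ ^ 2 * main : ℝ) : ℂ) else 0)‖
      = ‖(Esum X τ m hq χ Δ V x - D) + (D - t 0 0) + (t 0 0 - (if χ = 1 then ((Δ ^ 2 * main : ℝ) : ℂ) else 0))‖ := by
        ring_nf
    _ ≤ ‖Esum X τ m hq χ Δ V x - D‖ + ‖D - t 0 0‖ + ‖t 0 0 - (if χ = 1 then ((Δ ^ 2 * main : ℝ) : ℂ) else 0)‖ :=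
        norm_add₃_le
    _ ≤ 3 * (1 / Δ / Real.sqrt K₀) * Eabs X τ m Δ V x + (∑ j ∈ IK, ‖tentCoeff Δ j‖) ^ 2 * B₁ + (B₁ + Δ ^ 2 * B₂) :=
        add_le_add (add_le_add hdec hDt) hmainterm
    _ = 3 * (1 / Δ / Real.sqrt K₀) * Eabs X τ m Δ V x + ((∑ j ∈ IK, ‖tentCoeff Δ j‖) ^ 2 + 1) * B₁ + Δ ^ 2 * B₂ := by
        ring

end Decomposition

end Literature.NumberTheory.Sieve.CubicSieve
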